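import Summits.QuantumFields.YangMills.Theses.OneCertifiedCube
import Summits.QuantumFields.YangMills.Theorems.ParabolicTrajectoryContinuumLimitOnTrajectoryStubOSLegsD_Assembly
import Summits.QuantumFields.YangMills.Theorems.ParabolicTrajectoryContinuumLimitOnTrajectoryStubArp
import Summits.QuantumFields.YangMills.Theorems.ParabolicTrajectoryContinuumLimitOnTrajectoryStubTransl
import Summits.QuantumFields.YangMills.Theorems.ParabolicTrajectoryContinuumLimitOnTrajectoryUvbOfUuvb
import Summits.QuantumFields.YangMills.Theorems.ParabolicTrajectoryContinuumLimitOnTrajectoryDefsE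
import Summits.QuantumFields.YangMills.Theorems.ParabolicTrajectoryContinuumLimitOnTrajectoryStubAxisSymmetry
import Summits.QuantumFields.YangMills.Theorems.ParabolicTrajectoryContinuumLimitOnTrajectoryUclTop
import Summits.QuantumFields.YangMills.Theorems.ConvexGribovBodyContinuumLegGivenGapStubRotOfPythagorean
import Summits.QuantumFields.YangMills.Theorems.ConvexGribovBodyContinuumLegGivenGapStubRotNiven
import Summits.QuantumFields.YangMills.Theorems.ConvexGribovBodyContinuumLegGivenGapStubRotHyper
import Summits.QuantumFields.YangMills.Theorems.OneCertifiedCubeContinuumLimitExistsStubOddTorusRP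
import Summits.QuantumFields.YangMills.Theorems.OneCertifiedCubeContinuumLimitExistsUvSchemeOfUvBounds
import Summits.QuantumFields.YangMills.Theorems.OneCertifiedCubeContinuumLimitExistsUvBoundsOfArrayExponent
import Summits.QuantumFields.YangMills.Theorems.OneCertifiedCubeContinuumLimitExistsUvBounds345
import Summits.QuantumFields.YangMills.Theorems.OneCertifiedCubeContinuumLimitExistsCbBounds345
import Summits.QuantumFields.YangMills.Theorems.ConvexGribovBodyContinuumLegGivenGapStubUclOfCscl
import Summits.QuantumFields.YangMills.Theorems.ConvexGribovBodyContinuumLegGivenGapStubAsympCS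
import Summits.QuantumFields.YangMills.Theorems.ConvexGribovBodyContinuumLegGivenGapStubSmallRotation
import Summits.QuantumFields.YangMills.Theorems.ConvexGribovBodyContinuumLegGivenGapStubBddSlabDensity

/-!
# Birth skeleton (BC3) for crux `ContinuumLimitExists` (stmt-QuantumFields-16124) — `Lines/birth.lean`

Registrar: `planner-skel-stmt-QuantumFields-16124-0` (skeleton-register one-shot; route
`route-QuantumFields-OneCertifiedCube`, re-audit bin REPAIRABLE), 2026-08-17.

Crux (route file `Theses/OneCertifiedCube.lean`, decl
`Summit.QuantumFields.YangMills.Theses.OneCertifiedCube.ContinuumLimitExists`, rank 3, the route's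
EXISTENCE LEG at weak coupling = the first four conjuncts of the re-typed summit clause `YangMills`):
`∀ G compact simple, ∃ r sch T, sch.HasWeakCouplingLimit ∧ IsYangMillsFor r sch T ∧
 T.IsNontrivial r.curvature ∧ T.IsNonGaussian r.curvature`.

## The cut: one constructive ∃-leg and three universal legs, glued by LANDED one-field packaging

The skeleton re-uses, unchanged, the landed vocabulary and the PROVED one-field Osterwalder–Schrader
packaging of the sibling crux `ContinuumLimitOnTrajectory` (route `ParabolicTrajectory`, line
`two-orbit-synchronisation`; every file below is a sorry-free `Theorems/` module, importable by any prover):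
`canon r sch` (canonical one-field renormalisation: same `(a, β, L)`, `c_{tr F²} = a⁻⁴`, exact torus-mean
centring, every other species renormalised to `0`), `ConvProducts`, `UUVB`/`UVB`, `AsympTransl`/`AsympRot`/
`AsympEuclid`, `ARP`, `UCL`, `ND2`, `ND3` (`…ContinuumLimitOnTrajectoryDefs{,B,C}.lean`), `PolyVolumeGrowth`,
`TorusSlabRP` (`…DefsC.lean`), and the landed theorems
`oneFieldOSLegs'` (p90720: `ConvProducts → UVB → AsympEuclid → ARP → UCL → ND2 → ND3 → ∃ T, IsYangMillsFor r
(canon r sch) T ∧ T.IsNontrivial r.curvature ∧ T.IsNonGaussian r.curvature`), `stub_arp : ARPOfRP` (p116117: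
`TorusSlabRP → UUVB → UVB → ARP`), `stub_transl : TranslOfUUVB` (`PolyVolumeGrowth → UUVB → AsympTransl`),
`uvb_of_uuvb : UUVB → UVB`, `asympEuclid_iff : AsympEuclid ↔ AsympTransl ∧ AsympRot`.

With that glue the crux splits into FOUR named pieces, each a classical sub-problem of constructive
Yang–Mills and none of them the crux or the summit:

* `stub_uvScheme` (∃, the CONSTRUCTIVE HEART; XL / open-problem): for every compact simple `G` there are a
  faithful lattice representation `r` and a scheme `sch` with `β_k → ∞` (weak coupling, honouring the sibling
  Disproof's `not_withoutAF_unconditional`: asymptotic freedom is load-bearing), polynomial volume growth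
  `a_k⁻¹ ≤ (a_k L_k)^N` (a free choice of the construction, needed by the seam kinematics of `stub_transl`),
  FULL-SEQUENCE CONVERGENCE of every canonical curvature `p`-point function on off-diagonal real product
  tensors (`ConvProducts` — UV stability with observables + uniqueness along the renormalised trajectory:
  Bałaban's programme stops before this), uniform-threshold E0′ bounds for all plaquette strings (`UUVB` —
  large-field control), and the two lattice non-degeneracy witnesses `ND2` (truncated two-point of the
  canonically normalised `tr F²` bounded away from `0`: pins the scheme to the critical asymptotic-freedom
  tuning, over/under-cooled schemes have canonical limit `0`) and `ND3` (three-point, the `IsNonGaussian`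
  witness; kill target IV′ of the sibling Disproof §8). NO rotation invariance, NO reflection positivity of
  the limit, NO clustering: alone it yields no `OSData`.
* `stub_rotationRestoration` (∀, the E1 burden; open): along EVERY such weak-coupling, polynomially growing,
  convergent, UV-bounded Wilson sequence the canonical curvature distributions are asymptotically invariant
  under proper rotations (`AsympRot`; off the critical tuning the limit functional is `0` and the clause is
  empty, AT the tuning it is O(4) restoration — irrelevance of the dimension-6 lattice artefacts; necessary
  condition III `crux_imp_isotropicRatio` of the sibling Disproof §7).
* `stub_oddTorusRP` (∀, M-sized, PROVABLE lattice kinematics): Osterwalder–Seiler reflection positivity of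
  Wilson's measure on the scheme's ODD tori `2L_k+1` for the SITE reflection `t ↦ −t` (`GaugeConfig.negReflect`)
  and slab observables at times `1 … w`, `2w ≤ L_k`, eventually in `k` — from `0 ≤ β_k` eventually. The tree
  has the mixed site/link odd-torus RP in the `t ↦ 1 − t` frame (`wilsonExpectation_oddReflectionPositive`,
  `ConstructiveQFTWave0OddRPProofs`) and a `negReflect` covariant-kernel form (`WilsonOddRPKernel`); the
  conjugation to `TorusSlabRP`'s edge sets is the content (the sibling line names `TorusSlabRP` as an INPUT,
  `…DefsC` §6, and feeds it from a torus OS gap; here it is a stub of its own, gap-free).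
* `stub_uniformClustering` (∀, the E4 burden = IR; open): along every such sequence the canonical curvature
  distributions cluster under spatial translations in the E4 format, eventually in `k` (`UCL`; given
  convergence this is exactly the cluster property of the LIMIT functional: empty off the critical tuning,
  uniqueness of the vacuum of continuum YM₄ at it — the qualitative shadow of the mass gap, with no rate).
* `ContinuumLimitExists_of` — the composition, a real proof: take `(r, sch)` from `stub_uvScheme`; `UVB` by
  `uvb_of_uuvb`; translations by `stub_transl`, rotations by `stub_rotationRestoration`, so `AsympEuclid` by
  `asympEuclid_iff`; `0 ≤ β_k` eventually from `β_k → ∞`, so `TorusSlabRP` by `stub_oddTorusRP` and `ARP` by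
  `stub_arp`; `UCL` by `stub_uniformClustering`; `oneFieldOSLegs'` packages `T` over ALL species with
  `IsYangMillsFor r (canon r sch) T`, non-trivial and non-Gaussian curvature; the witness of the crux is
  `(r, canon r sch, T)` — `canon` keeps `β`, so `(canon r sch).HasWeakCouplingLimit` is the weak-coupling
  clause of `stub_uvScheme`. The `example` after it is the same glue with the four stub STATEMENTS as
  explicit hypotheses and no reference to the stubs (sorry-free by inspection of its axioms).

## Status (honest)
`stub_uvScheme` carries the bulk of the Clay-level difficulty (UV stability WITH gauge-invariant
observables, convergence, non-degeneracy); `stub_rotationRestoration` and `stub_uniformClustering` are the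
two classical burdens (E1, E4) that no UV technology delivers and that the crux as typed demands (`OSData`
has E1 and E4 as fields); `stub_oddTorusRP` is provable now. No stub is cheaply the crux or the summit:
the ∃-stub has no E1/E2/E4 content, the ∀-stubs construct nothing; BC3 probes
(`stub → ContinuumLimitExists`, `stub → YangMills` by `first | exact? | simpa | aesop`, registrar folder
`bc/*_probe.lean`) fail 8/8. Conversely the crux does not cheaply give `stub_uvScheme` (an arbitrary
witness scheme need not converge in the CANONICAL normalisation, nor obey `UUVB` or volume growth).

## Disproof used
No `Cruxes/ContinuumLimitExists/Disproof.lean` exists (no workfiles before this one); negatives index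
(`ledger negatives --problem QuantumFields`, 5 entries, 2026-08-17): none concerns these predicates. From the
sibling crux's `Cruxes/ContinuumLimitOnTrajectory/Disproof.lean` (cdisprove gen 3): weak coupling is
load-bearing (`not_withoutAF_unconditional`) — carried by `stub_uvScheme` and threaded to the witness; the
one-field witness is legal (`crux_iff_oneField`, F6/F7) — the composition IS the one-field route via `canon`;
kill targets III (anisotropy) and IV′ (Gaussian `tr F²`) are met head-on by `stub_rotationRestoration` and the
`ND3` clause.

`lean check` (birth, registrar): rc 0; sorries = 4 = stubs (`stub_uvScheme`, `stub_rotationRestoration`,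
`stub_oddTorusRP`, `stub_uniformClustering`), zero elsewhere. Namespace
`Summit.QuantumFields.YangMills.Cruxes.ContinuumLimitExists.Birth`.

## Lead log (line lead `prover-line-stmt-QuantumFields-16124-0`, gen 1)
* v2 (cycle 1, 2026-08-17): `stub_oddTorusRP` CLOSED — its statement is verbatim the landed sibling theorem
  `TwoOrbitSynchronisation.torusSlabRP_of_eventually_nonneg` (`…ContinuumLimitOnTrajectorySlabRP.lean`, p124885); landed
  under the registered name as `Theorems/OneCertifiedCubeContinuumLimitExistsStubOddTorusRP.lean` (p146480, `--supports`).
  rc 0; sorries = 3 (`stub_uvScheme` — lead; `stub_rotationRestoration`, `stub_uniformClustering` — wave 1).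
* v3 (cycle 1, after wave 1 — both workers `stub-blocked: none` with verified residuals): the landed stub 3 is IMPORTED
  (`…Birth.stub_oddTorusRP`, p146480 ACCEPTED) and the two universal physics legs are RESHAPED to their sharpest tree
  residuals, the compositions being LANDED sibling theorems:
  - `stub_rotationRestoration` (⊢ `AsympRot`) ↦ `stub_rotation345` (⊢ `Rot345 r sch`, asymptotic invariance under ONE
    Pythagorean rotation, `…DefsE`): `AsympRot` follows by `ContinuumLegGivenGap.stub_rotOfPythagorean G r sch stub_rotNiven
    stub_rotHyper hU h345` (p133709/p133202/p133520; Niven + closed angle set from the k-uniform E0′ bound + exact axis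
    symmetry + Givens generation) — verified term, worker 1;
  - `stub_uniformClustering` (⊢ `UCL`, spatial E4 format) ↦ `stub_coreClustering` (⊢ `CoreClustering r sch`, `…UclDefs`:
    rate-free TIME clustering of the canonical curvature distributions on locus-avoiding tensors separated by a spatial
    coordinate): `UCL` follows gap-free, rate-free and rotation-free by `ucl_of_core r sch (stub_axisSymmetry G r sch) hGr hU
    hcore` (`…UclTop`, `…StubAxisSymmetry` p115410) — verified term, worker 2 (degenerate arities n = 0 ∨ m = 0 are free from
    `stub_transl`; the first clause needing an IR input is n = m = 1: spatial decay of the canonical `tr F²` two-point function).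
  Neither residual is derivable from the stub hypotheses (no tree fact produces `Rot345`; the only tree producer of
  `CoreClustering`, `coreClustering_of`, consumes the slack-free `TorusOSGap`, unsatisfiable on periodic tori) and neither is
  refutable in the tree. rc 0; sorries = 3 (`stub_uvScheme`, `stub_rotation345`, `stub_coreClustering`).
* v4 (continuation lead `prover-line-stmt-QuantumFields-16124-c1-0`, cycle c1, 2026-08-17): stubs UNCHANGED (the c1 wave — two search-first
  workers over all 44 `curvDistribution` files and the rotation/clustering routes — found no producer of `Rot345` or `CoreClustering` for an
  arbitrary scheme: `stub-blocked: UVPhysics345` resp. `stub-blocked: SpeciesScheme.HasCSClustering`). Landed alongside (not imported here, heavy closure): the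
  SUPPLIER WEB of the crux (`Theorems/OneCertifiedCubeContinuumLimitExistsSuppliers.lean`, p157236: `YangMills → E`; E ⇐ the lattice-gap item ∧
  continuum-leg item of routes ContractibleFibre / GronwallGap / EquipartitionCriticality). Added here, sorry-free: the ALTERNATIVE E4 FEED in the currency of the shared infrared item of
  crux stmt-10522 (child I, `IRPhysicsCS` 2nd conjunct): `ucl_of_csClustering` — `UCL` from `∃ Δ₁ > 0, HasCSClustering r (canon r sch) Δ₁` + `AsympRot`
  + weak coupling + growth + `UUVB` by the landed `ContinuumLegGivenGap.stub_uclOfCscl` (p132690) with its three landed generic inputs — and the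
  composition `example (hCS : …) : ContinuumLimitExists` (stubs 1–2 by name + that ∀-statement as a HYPOTHESIS): the IR stub of this line may be
  either the rate-free `CoreClustering` (registered, minimal for the gap-free E) or the shared rate-`Δ₁` CS clustering, with no other change.
* v5 (continuation lead `prover-line-stmt-QuantumFields-16124-c2-0`, cycle c2, 2026-08-17): the ∃-stub is RESHAPED — CONVERGENCE IS FREE.
  `stub_uvScheme` (weak ∧ PVG ∧ ConvProducts ∧ UUVB ∧ ND2 ∧ ND3) ↦ `stub_uvBounds` (weak ∧ PVG ∧ UUVB ∧ ND2 ∧ ND3): the crux is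
  existential in the scheme and every other clause is an `∀ᶠ k` / `Tendsto` statement, so full-sequence convergence on products is
  obtained along a SUB-SCHEME by the landed compactness extraction of crux stmt-QuantumFields-15828
  (`ContinuumLegGivenGap.exists_subseq_convProducts_of_uuvb`: uniform-threshold bound from `UUVB` + Cantor diagonal over a countable
  family dense in `⁰𝒮` for every finite family of Schwartz seminorms, `separableSpace_schwartzMap_holds`), the other five clauses riding
  along (`Literature.Barriers.QuantumFields.subScheme`). Glue LANDED as `Theorems/OneCertifiedCubeContinuumLimitExistsUvSchemeOfUvBounds.lean`
  (`uvScheme_of_uvBounds` = registered anchor: the v4 ∃-stub statement follows from the v5 one; `exists_subScheme_convProducts`;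
  transport lemmas). Consequence for the crux's residue: the uniqueness / synchronisation content of the two-orbit architecture
  (`ChartExists`, `TwoOrbitSync`, `QualFiniteSizeInput` of `uvScheme345_of_twoOrbit`) is NOT part of the burden of E; the constructive
  leg is exactly UV STABILITY WITH OBSERVABLES (`UUVB`, k-uniform E0′ bounds in the canonical normalisation) and NON-DEGENERACY
  (`ND2 ∧ ND3`) along SOME weak-coupling, polynomially growing Wilson sequence — the compactness route, which the barrier
  `UVStabilityNonUniqueness` does not obstruct for an existential sequential scheme (its 2026-08-16 audit). The ∀-stubs are unchanged
  (they are applied to the sub-scheme). rc 0; sorries = 3 (`stub_uvBounds`, `stub_rotation345`, `stub_coreClustering`).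
* v5 + chessboard glue (continuation lead `prover-line-stmt-QuantumFields-16124-c3-0`, cycle c3, 2026-08-17): stubs UNCHANGED
  (re-registered 13:40Z; wave c3 on the two ∀-stubs). LANDED p164124 `Theorems/OneCertifiedCubeContinuumLimitExistsUvBoundsOfArrayExponent.lean`:
  the ∃-stub's only MANY-BODY clause `UUVB` is ONE-BODY modulo provable lattice analysis — along a weak-coupling, polynomially growing scheme
  whose tori are eventually TRIADIC (`2L_k+1 = 3^M`, a free choice for an ∃-crux) a `k`-uniform bound on the one-body array exponents
  `arrayRoot r β_k a_k L_k m v z₀ q f ≤ C·max(ℓ,ℓ⁻¹)^p·cellNorm s ℓ f` (`ℓ = a_k 3^m/2`; the gap-free, scheme-wise form of the bet (CB) of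
  15828's line `alternating-curvature-arrays`) gives `ProductBound r sch` by the LANDED Fröhlich–Israel–Lieb–Simon chessboard estimate
  `ContinuumLegGivenGap.arrays_chessboard` (p162501) — `productBound_of_arrayExponent` — and then `UUVB r sch` by the Whitney / grid-shift step
  `PolyVolumeGrowth → ProductBound → UUVB` (= 15828's `stub_productToUniform`, pure lattice analysis in flight there as `stub_ptu*`; a HYPOTHESIS
  here, never a stub of this line) — `uuvb_of_arrayExponent`, `uvBounds_of_arrayExponent` (registered anchor: v5 ∃-stub statement ⇐ PTU + the
  one-body ∃-statement), `continuumLimitExists_of_cbStubs` (E by name from PTU + one-body ∃ + stubs 2, 4). The `example` at the end of this file is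
  that prospective composition; the one-body reshape (`UUVB` clause ↦ eventually-triadic ∧ CB; v7 after the v6 below) is registered the
  moment PTU lands in the tree. rc 0; sorries = 3 (unchanged at that point).
* v6 (continuation lead c3, after wave c3, 2026-08-17): THE E1 LEG RIDES INSIDE THE ∃-STUB. Wave c3 (2 search-first workers; 218 Theorems/Theses
  files landed since 11:00Z scanned): both ∀-stubs `stub-blocked` with 0 gap-free producers — `stub_coreClustering` on the ∀-scheme
  `SpeciesScheme.HasCSClustering r (canon r sch)` physics (every tree producer of `CoreClustering`/`UCL`/`HasCSClustering(canon)` is gap-conditional),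
  `stub_rotation345` on `UVEngine345` WITH THE CAVEAT that `UVEngine345`/`UVPhysics345`/15828's child 2 deliver `Rot345` only along tuned or
  constructed sequences: NO filed item or def of the hub implies the ∀-scheme form of `stub_rotation345`. Since the crux is existential and `Rot345`
  is sub-scheme-stable (`rot345_subScheme`, worker's kernel-checked suggestion), v6 folds E1 into the constructed sequence:
  `stub_uvBounds` + `stub_rotation345` ↦ `stub_uvBounds345 : ∀ G, … → ∃ r sch, weak ∧ PVG ∧ UUVB ∧ Rot345 ∧ ND2 ∧ ND3` — the weakest honest
  form (E1 claimed only where E needs it) and the existential gap-free shadow of the UV packages the sibling chains want (`UVScheme345` of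
  `…ContinuumLimitExistsDefs`; 10522's `UVPhysics345`; 15828's child 2 + child 3). Glue LANDED as
  `Theorems/OneCertifiedCubeContinuumLimitExistsUvBounds345.lean` (p165122): `uvScheme345_of_uvBounds345` (⇒ `UVScheme345`, convergence free),
  `continuumLimitExists_of_uvScheme345` (anchor: `UVScheme345` + the E4 ∀-statement ⇒ E — every `UVScheme345` supplier, e.g.
  `uvScheme345_of_twoOrbit` p150943, now closes E given the IR statement), `continuumLimitExists_of_stubs345` (anchor: the v6 composition as a
  tree theorem), `uvBounds345_of_arrayExponent` / `continuumLimitExists_of_cbStubs345` (the same with the UV clause one-body, prospective v7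
  once PTU lands). rc 0; sorries = 2 (`stub_uvBounds345` — lead; `stub_coreClustering` — IR).
* v7 (continuation lead c3, 2026-08-17 ~14:50Z): THE ∃-STUB IS REGISTERED IN ONE-BODY FORM. PTU became a tree theorem during the cycle (chain 15828 landed
  `stub_ptu{Geometry,Derivatives,Analysis,Assembly}` and their composition `ContinuumLegGivenGap.arrays_productToUniform`), so the chessboard reduction of c3 is unconditional:
  `stub_uvBounds345` ↦ `stub_cbBounds345 : ∀ G, … → ∃ r sch, weak ∧ PVG ∧ (∀ᶠ k, IsTriadic (sch.L k)) ∧ CB(r, sch) ∧ Rot345 ∧ ND2 ∧ ND3`, `CB` the k-uniform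
  one-body array-exponent bound `arrayRoot r β_k a_k L_k m v z₀ q f ≤ C·max(ℓ,ℓ⁻¹)^p·cellNorm s ℓ f` along the scheme's own tori; the v6 statement is DERIVED
  (`uvBounds345_of_stub := uvBounds345_of_cbBounds345 stub_cbBounds345`, glue p166875), the composition is unchanged, and `continuumLimitExists_of_cbBounds345`
  (p166875) is the v7 composition as a tree theorem. Tightness: the over-cooled TRIADIC scheme has weak ∧ PVG ∧ triadic ∧ CB ∧ ConvProducts ∧ Rot345 ∧
  CoreClustering ∧ ¬ND2 ∧ ¬ND3 (`Negative/OvercooledTriadic{Scheme,ArrayExponent}`, p165981 + p166588) — `ND2 ∧ ND3` stay load-bearing. A supplier proving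
  `UUVB` directly still closes E by the landed `continuumLimitExists_of_stubs345` (p165122). rc 0; sorries = 2 (`stub_cbBounds345` — lead; `stub_coreClustering` — IR).
-/

set_option autoImplicit false

noncomputable section

namespace Summit.QuantumFields.YangMills.Cruxes.ContinuumLimitExists.Birth

open Filter Topology
open Literature.MathematicalPhysics.QuantumFieldTheory
open Summit.QuantumFields.YangMills.Cruxes.ContinuumLimitOnTrajectory.TwoOrbitSynchronisation
open Summit.QuantumFields.YangMills.Theorems.ContinuumLegGivenGap.AlternatingArrays

/-! ## § Stubs — the ONLY `sorry`s of the file (v7, c3: two — stub 1 (reshaped: `stub_cbBounds345`, one-body, absorbing stub 2) and stub 4; stub 3 is landed) -/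

/-- **Stub 1 `stub_cbBounds345` (v7; one-body form of v6's `stub_uvBounds345`, which absorbed `stub_uvBounds` and `stub_rotation345`) — the
constructive ∃-leg in ONE-BODY form (XL; open-problem).** For every compact simple `G`: a faithful lattice representation `r` and a sequential
scheme `sch` at WEAK COUPLING (`β_k → ∞`) with polynomial volume growth on eventually TRIADIC tori (`2L_k+1 = 3^M`, a free choice for an ∃-crux),
along which
* (CB) the ONE-BODY array exponents of the canonically renormalised (`c = a_k⁻⁴`), exactly centred, smeared single-plaquette field obey a `k`-uniform
  canonical-scaling bound `arrayRoot r β_k a_k L_k m v z₀ q f ≤ C·max(ℓ,ℓ⁻¹)^p·cellNorm s ℓ f` (`ℓ = a_k 3^m/2` the physical cell side; all admissible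
  levels, grid offsets, home cells in the central half-box, orientations, core-supported real `f`) — a free energy per cell of the periodic mirror array,
  factorial-free in the cell count; by the LANDED Fröhlich–Israel–Lieb–Simon chessboard estimate and Whitney step it gives the uniform-threshold E0′ bounds
  `UUVB` for all plaquette strings (`uvBounds345_of_cbBounds345`, p166875; UV stability WITH observables, Bałaban class, in one-body clothing);
* (`Rot345`) the canonical curvature distributions are asymptotically invariant under the ONE Pythagorean rotation of the `(x⁰,x¹)`-plane (the E1 burden,
  claimed only along this sequence; all of `SO(4)` then by the landed `stub_rotOfPythagorean`);
* (`ND2`, `ND3`) the canonical curvature two- and three-point functions have floors (the `IsNontrivial` / `IsNonGaussian` witnesses; they pin the unit to the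
  confinement scale and are the LOAD-BEARING conjuncts: the over-cooled triadic scheme has everything else and `¬ND2 ∧ ¬ND3`, p166588).
NO convergence, NO reflection positivity of the limit, NO clustering is claimed; convergence on products along a sub-scheme is FREE. The existential,
gap-free, one-body shadow of `UVScheme345` / 10522's `UVPhysics345` / 15828's child 2 + child 3 (+ its (CB) bet). -/
theorem stub_cbBounds345 :
    ∀ (G : Type) [Group G] [TopologicalSpace G] [IsTopologicalGroup G] [CompactSpace G]
      [MeasurableSpace G] [BorelSpace G], IsCompactSimpleLieGroup G →
      ∃ (r : LatticeRep G) (sch : SpeciesScheme (YMSpecies G)),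
        sch.HasWeakCouplingLimit ∧ PolyVolumeGrowth sch ∧ (∀ᶠ k in atTop, IsTriadic (sch.L k)) ∧
        (∃ (C : ℝ) (p s k₀ : ℕ), 0 ≤ C ∧
          ∀ k : ℕ, k₀ ≤ k → ∀ (m : ℕ) (v z₀ : Fin 4 → ℤ) (q : PlaqIdx)
            (f : SchwartzMap (EuclideanSpace ℝ (Fin 4)) ℝ),
            LevelAdmissible (sch.L k) m → CellInHalfBox (sch.L k) m v z₀ →
            tsupport f ⊆ physCore (sch.a k) m v z₀ →
            arrayRoot r (sch.β k) (sch.a k) (sch.L k) m v z₀ q f ≤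
              C * max (sch.a k * cellSide m) (sch.a k * cellSide m)⁻¹ ^ p *
                cellNorm s (sch.a k * cellSide m) f) ∧
        Rot345 r sch ∧ ND2 r sch ∧ ND3 r sch := by
  sorry

/-- **The v6 statement, DERIVED (v7 glue, landed p166875)**: weak ∧ PVG ∧ UUVB ∧ Rot345 ∧ ND2 ∧ ND3 along one Wilson sequence per compact simple `G`,
from `stub_cbBounds345` by the chessboard reduction with PTU discharged (`uvBounds345_of_cbBounds345`). -/
theorem uvBounds345_of_stub :
    ∀ (G : Type) [Group G] [TopologicalSpace G] [IsTopologicalGroup G] [CompactSpace G]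
      [MeasurableSpace G] [BorelSpace G], IsCompactSimpleLieGroup G →
      ∃ (r : LatticeRep G) (sch : SpeciesScheme (YMSpecies G)),
        sch.HasWeakCouplingLimit ∧ PolyVolumeGrowth sch ∧ UUVB r sch ∧ Rot345 r sch ∧ ND2 r sch ∧ ND3 r sch :=
  uvBounds345_of_cbBounds345 stub_cbBounds345

/-- **`UVScheme345`, DERIVED (v6 glue, landed)**: a weak-coupling, polynomially growing, PRODUCT-CONVERGENT, UV-bounded, one-rotation
invariant, non-degenerate one-field Wilson sequence for every compact simple `G` — from `uvBounds345_of_stub` by the compactness extraction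
`uvScheme345_of_uvBounds345` (sub-scheme along which `ConvProducts` holds; the other clauses ride along). -/
theorem uvScheme345_of_stub : UVScheme345 :=
  uvScheme345_of_uvBounds345 uvBounds345_of_stub

/-! **Stub 2 `stub_rotation345` — RETIRED in v6** (absorbed into `stub_uvBounds345`; its ∀-scheme statement
`∀ r sch, weak → PVG → ConvProducts → UUVB → Rot345 r sch` is implied by no filed item of the hub, c3 wave). The landed v5 compositions
that consume it as a hypothesis (`continuumLimitExists_of_birthStubs` p160494, `continuumLimitExists_of_cbStubs` p164124) remain valid tree theorems. -/

/-- **E1 from the one-rotation clause (v3 glue, LANDED sibling theorems; in v6 the clause is carried by stub 1)**: full proper-rotation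
restoration `AsympRot` from `UUVB` and the one-rotation residual `Rot345` — `ContinuumLegGivenGap.stub_rotOfPythagorean` with `stub_rotNiven`, `stub_rotHyper`. -/
theorem asympRot_of_rotation345 {G : Type} [Group G] [TopologicalSpace G] [IsTopologicalGroup G] [CompactSpace G]
    [MeasurableSpace G] [BorelSpace G] (r : LatticeRep G) (sch : SpeciesScheme (YMSpecies G))
    (hU : UUVB r sch) (h345 : Rot345 r sch) : AsympRot r sch :=
  Summit.QuantumFields.YangMills.Theorems.ContinuumLegGivenGap.stub_rotOfPythagorean G r sch
    Summit.QuantumFields.YangMills.Theorems.ContinuumLegGivenGap.stub_rotNiven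
    Summit.QuantumFields.YangMills.Theorems.ContinuumLegGivenGap.stub_rotHyper hU h345

/-! **Stub 3 `stub_oddTorusRP` — CLOSED and LANDED** (p146480, `Theorems/OneCertifiedCubeContinuumLimitExistsStubOddTorusRP.lean`,
imported above; decl `Summit.QuantumFields.YangMills.Cruxes.ContinuumLimitExists.Birth.stub_oddTorusRP :
∀ G … r sch, (∀ᶠ k in atTop, 0 ≤ sch.β k) → TorusSlabRP r sch`, the landed sibling theorem
`torusSlabRP_of_eventually_nonneg`, p124885). -/

/-- **Stub 4 `stub_coreClustering` (v3; replaces `stub_uniformClustering`) — the E4 burden in its sharpest tree form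
(IR; open).** Along every weak-coupling, polynomially growing Wilson sequence whose canonical curvature functions
converge on products with uniform plaquette-string bounds, the canonical curvature distributions cluster RATE-FREE in
the TIME direction on locus-avoiding tensors whose supports are separated by a spatial coordinate (`CoreClustering r sch`,
`…UclDefs`): for `Low ⊗ T_{tb} Up` with `0 < b 0`, `‖𝓓(Low ⊗ T_{tb}Up) − 𝓓(Low)·𝓓(T_{tb}Up)‖ ≤ ε` for `t ≥ t₀(ε, …)`,
eventually in `k`. The spatial E4 format `UCL` then follows gap-free and rotation-free from exact axis symmetry, `UUVB`
and volume growth (`ucl_of_core`, landed; `ucl_of_coreClustering` below). Given convergence this is the cluster property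
(uniqueness of the vacuum) of the continuum limit functional — the rate-free shadow of the mass gap; the first clause
with content is the two-point one (n₁ = n₂ = 1). -/
theorem stub_coreClustering :
    ∀ (G : Type) [Group G] [TopologicalSpace G] [IsTopologicalGroup G] [CompactSpace G]
      [MeasurableSpace G] [BorelSpace G], IsCompactSimpleLieGroup G →
      ∀ (r : LatticeRep G) (sch : SpeciesScheme (YMSpecies G)),
        sch.HasWeakCouplingLimit → PolyVolumeGrowth sch → ConvProducts r sch → UUVB r sch →
          CoreClustering r sch := by
  sorry

/-- **E4 input from stub 4 (v3 glue, LANDED sibling theorems)**: `UCL` from `CoreClustering`, exact axis symmetry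
(`stub_axisSymmetry`), volume growth and `UUVB` — `ucl_of_core`. -/
theorem ucl_of_coreClustering {G : Type} [Group G] [TopologicalSpace G] [IsTopologicalGroup G] [CompactSpace G]
    [MeasurableSpace G] [BorelSpace G] (r : LatticeRep G) (sch : SpeciesScheme (YMSpecies G))
    (hGr : PolyVolumeGrowth sch) (hU : UUVB r sch) (hcore : CoreClustering r sch) : UCL r sch :=
  ucl_of_core r sch (stub_axisSymmetry G r sch) hGr hU hcore

/-- **Alternative E4 feed (v4 glue, LANDED sibling theorems)**: `UCL` from ε-slack Cauchy–Schwarz clustering of the CANONICAL scheme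
at some physical rate `Δ₁ > 0` (`SpeciesScheme.HasCSClustering r (canon r sch) Δ₁` — the second conjunct of the shared infrared input
`IRPhysicsCS` of crux stmt-QuantumFields-10522), given `AsympRot`, weak coupling, volume growth and `UUVB`:
`ContinuumLegGivenGap.stub_uclOfCscl` (p132690) with its landed generic inputs `stub_asympCS`, `stub_smallRotation`, `stub_bddSlabDensity`. -/
theorem ucl_of_csClustering {G : Type} [Group G] [TopologicalSpace G] [IsTopologicalGroup G] [CompactSpace G]
    [MeasurableSpace G] [BorelSpace G] (r : LatticeRep G) (sch : SpeciesScheme (YMSpecies G))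
    (hW : sch.HasWeakCouplingLimit) (hGr : PolyVolumeGrowth sch) (hU : UUVB r sch) (hRot : AsympRot r sch)
    (hCS : ∃ Δ₁ : ℝ, 0 < Δ₁ ∧ SpeciesScheme.HasCSClustering r (canon r sch) Δ₁) : UCL r sch :=
  Summit.QuantumFields.YangMills.Theorems.ContinuumLegGivenGap.stub_uclOfCscl G r sch
    Summit.QuantumFields.YangMills.Theorems.ContinuumLegGivenGap.stub_asympCS
    Summit.QuantumFields.YangMills.Theorems.ContinuumLegGivenGap.stub_smallRotation
    Summit.QuantumFields.YangMills.Theorems.ContinuumLegGivenGap.stub_bddSlabDensity hW hU hGr hRot hCS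

/-! ## § Assembly — sorry-free glue; concludes the route decl BY NAME -/

/-- **Composition (v7)**: the stubs BY NAME — stub 1 through the landed chessboard / PTU / compactness glue `uvScheme345_of_stub` (which also
carries the one-rotation clause), stub 4 directly — and the landed one-field packaging of the sibling line give the crux BY NAME. Witness
`(r, canon r sch, T)` with `sch` the extracted sub-scheme; `canon` keeps `β`, so the weak-coupling clause is inherited. -/
theorem ContinuumLimitExists_of :
    Summit.QuantumFields.YangMills.Theses.OneCertifiedCube.ContinuumLimitExists := by
  intro G _ _ _ _ hG
  letI : MeasurableSpace G := borel G
  haveI : BorelSpace G := ⟨rfl⟩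
  -- Stub 1 (v7: `stub_cbBounds345`, one-body) + landed chessboard/PTU + compactness glue: the convergent (along a sub-scheme), UV-bounded,
  -- one-rotation invariant, non-degenerate weak-coupling one-field sequence
  obtain ⟨r, sch, hW, hGr, hconv, hU, h345, hND2, hND3⟩ := uvScheme345_of_stub G hG
  -- landed kinematics: E0′ bounds and the translation half of E1
  have hUVB : UVB r sch := uvb_of_uuvb r sch hU
  have hTr : AsympTransl r sch := stub_transl G r sch hGr hU
  -- the rotation half of E1: the package's one Pythagorean rotation + landed upgrade
  have hRot : AsympRot r sch := asympRot_of_rotation345 r sch hU h345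
  have hE1 : AsympEuclid r sch := (asympEuclid_iff r sch).2 ⟨hTr, hRot⟩
  -- Stub 3 (landed): reflection positivity on the odd tori (`0 ≤ β_k` eventually, from `β_k → ∞`), then landed ARP
  have hβ : ∀ᶠ k in Filter.atTop, 0 ≤ sch.β k := hW.eventually_ge_atTop 0
  have hRP : TorusSlabRP r sch := stub_oddTorusRP G r sch hβ
  have hARP : ARP r sch := stub_arp G r sch hRP hU hUVB
  -- Stub 4 (rate-free time clustering) + landed upgrade: uniform spatial clustering (E4)
  have hUCL : UCL r sch := ucl_of_coreClustering r sch hGr hU (stub_coreClustering G hG r sch hW hGr hconv hU)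
  -- landed packaging (`oneFieldOSLegs'`): OS data over ALL species, Yang–Mills along `canon r sch`
  obtain ⟨T, hYM, hNT, hNG⟩ := oneFieldOSLegs' G r sch hconv hUVB hE1 hARP hUCL hND2 hND3
  exact ⟨r, canon r sch, T, hW, hYM, hNT, hNG⟩

/-- **Composition with the SHARED infrared currency (v4, updated v6)**: stub 1 BY NAME, and — instead of stub 4 — the `∀`-statement
"CS clustering of the canonical scheme at some rate along every weak-coupling, polynomially growing, product-convergent, UUVB sequence"
as an explicit HYPOTHESIS `hCS` (not a registered stub: it is the second conjunct of `IRPhysicsCS`, the candidate SHARED IR item of cruxes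
stmt-10522 / stmt-16124 per the c3 wave). Shows that swapping the IR stub changes nothing else in the line. -/
example
    (hCS : ∀ (G : Type) [Group G] [TopologicalSpace G] [IsTopologicalGroup G] [CompactSpace G]
      [MeasurableSpace G] [BorelSpace G], IsCompactSimpleLieGroup G →
      ∀ (r : LatticeRep G) (sch : SpeciesScheme (YMSpecies G)),
        sch.HasWeakCouplingLimit → PolyVolumeGrowth sch → ConvProducts r sch → UUVB r sch →
          ∃ Δ₁ : ℝ, 0 < Δ₁ ∧ SpeciesScheme.HasCSClustering r (canon r sch) Δ₁) :
    Summit.QuantumFields.YangMills.Theses.OneCertifiedCube.ContinuumLimitExists := by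
  intro G _ _ _ _ hG
  letI : MeasurableSpace G := borel G
  haveI : BorelSpace G := ⟨rfl⟩
  obtain ⟨r, sch, hW, hGr, hconv, hU, h345, hND2, hND3⟩ := uvScheme345_of_stub G hG
  have hUVB : UVB r sch := uvb_of_uuvb r sch hU
  have hRot : AsympRot r sch := asympRot_of_rotation345 r sch hU h345
  have hE1 : AsympEuclid r sch := (asympEuclid_iff r sch).2 ⟨stub_transl G r sch hGr hU, hRot⟩
  have hARP : ARP r sch := stub_arp G r sch (stub_oddTorusRP G r sch (hW.eventually_ge_atTop 0)) hU hUVB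
  have hUCL : UCL r sch := ucl_of_csClustering r sch hW hGr hU hRot (hCS G hG r sch hW hGr hconv hU)
  obtain ⟨T, hYM, hNT, hNG⟩ := oneFieldOSLegs' G r sch hconv hUVB hE1 hARP hUCL hND2 hND3
  exact ⟨r, canon r sch, T, hW, hYM, hNT, hNG⟩

/-- **The glue alone, `sorry`-free (v6 shape, still valid in v7 via `uvBounds345_of_stub`)**: the stub STATEMENTS (`h₁` is the v6 ∃-statement WITHOUT convergence; `h₃` is the landed
stub 3; `h₄` is `stub_coreClustering`) imply the crux; this `example` does not mention the open stubs (the landed theorem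
`continuumLimitExists_of_stubs345`, p165122, is the same with `h₃` discharged). -/
example
    (h₁ : ∀ (G : Type) [Group G] [TopologicalSpace G] [IsTopologicalGroup G] [CompactSpace G]
      [MeasurableSpace G] [BorelSpace G], IsCompactSimpleLieGroup G →
      ∃ (r : LatticeRep G) (sch : SpeciesScheme (YMSpecies G)),
        sch.HasWeakCouplingLimit ∧ PolyVolumeGrowth sch ∧ UUVB r sch ∧ Rot345 r sch ∧ ND2 r sch ∧ ND3 r sch)
    (h₃ : ∀ (G : Type) [Group G] [TopologicalSpace G] [IsTopologicalGroup G] [CompactSpace G]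
      [MeasurableSpace G] [BorelSpace G] (r : LatticeRep G) (sch : SpeciesScheme (YMSpecies G)),
      (∀ᶠ k in Filter.atTop, 0 ≤ sch.β k) → TorusSlabRP r sch)
    (h₄ : ∀ (G : Type) [Group G] [TopologicalSpace G] [IsTopologicalGroup G] [CompactSpace G]
      [MeasurableSpace G] [BorelSpace G], IsCompactSimpleLieGroup G →
      ∀ (r : LatticeRep G) (sch : SpeciesScheme (YMSpecies G)),
        sch.HasWeakCouplingLimit → PolyVolumeGrowth sch → ConvProducts r sch → UUVB r sch →
          CoreClustering r sch) :
    Summit.QuantumFields.YangMills.Theses.OneCertifiedCube.ContinuumLimitExists := by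
  intro G _ _ _ _ hG
  letI : MeasurableSpace G := borel G
  haveI : BorelSpace G := ⟨rfl⟩
  obtain ⟨r, sch, hW, hGr, hconv, hU, h345, hND2, hND3⟩ := uvScheme345_of_uvBounds345 h₁ G hG
  have hUVB : UVB r sch := uvb_of_uuvb r sch hU
  have hE1 : AsympEuclid r sch :=
    (asympEuclid_iff r sch).2 ⟨stub_transl G r sch hGr hU, asympRot_of_rotation345 r sch hU h345⟩
  have hARP : ARP r sch := stub_arp G r sch (h₃ G r sch (hW.eventually_ge_atTop 0)) hU hUVB
  obtain ⟨T, hYM, hNT, hNG⟩ :=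
    oneFieldOSLegs' G r sch hconv hUVB hE1 hARP
      (ucl_of_coreClustering r sch hGr hU (h₄ G hG r sch hW hGr hconv hU)) hND2 hND3
  exact ⟨r, canon r sch, T, hW, hYM, hNT, hNG⟩

/-- **The v7 composition through the landed anchor** (p166875): the two registered stubs BY NAME into `continuumLimitExists_of_cbBounds345`
— the same proof of the item as `ContinuumLimitExists_of`, packaged as one tree theorem applied to the stubs. -/
example : Summit.QuantumFields.YangMills.Theses.OneCertifiedCube.ContinuumLimitExists :=
  continuumLimitExists_of_cbBounds345 stub_cbBounds345 stub_coreClustering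

end Summit.QuantumFields.YangMills.Cruxes.ContinuumLimitExists.Birth

end
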